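import Summits.QuantumFields.YangMills.Theorems.BalabanUVNodesN15KingModelBoxNormalisationRate
import HarnessLib

/-!
# BalabanUVNodes ∕ N15 — THE KING-MODEL RUNG (PART Ϟ-h): COMPLETENESS OF THE COSINE BASIS ON KING's REGION `Ω`, EXACT QUADRATIC-FORM SPECTRAL BOUNDS, AND NE2's UNIT LAYER ON `Ω`
# IN OPERATOR NORM: `‖((Δ^{(K)}_Ω)⁻¹ − (Δ^{(∞)}_Ω)⁻¹)f‖ ≤ δ_∞⁻²·C_Δ(a)·L^{−2K}·‖f‖` — THE `η²`-RATE, UNIFORM IN THE BOX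
# (Track A, DAG node N15 = NE2 «η-rates of the covariance pieces»; FAN-OUT v1.1 §N15 s3 «KING-MODEL RUNG»; King p.670 l.8–13; count-neutral)

HONEST FRAMING.  Count-neutral (cell `pub-ymgap`, seat `pub-ymgap-dag-n15-e` g41; `--supports stmt-QuantumFields-27366 --as helper` = K3⁸).
TEMPLATE LITERATURE: C. King, Commun. Math. Phys. **102** (1986) 649–677 [King1986]: (2.14) p.653 (`Δ^{(k)}`, its inverse = NE2's unit-lattice covariance in the model), Lemma 4.3
(4.18) p.672 (the symbol rate `|Δ^{(k)}(p′) − Δ^{(∞)}(p′)| ≤ O(1)L^{−2k}`), (4.5) p.670, (4.8) p.671 (uniform bounds of the symbol), §4 p.670 l.8–13 (free boundary conditions on `Ω`).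
Parts Ϟ-a∕Ϟ-b∕Ϟ-c gave the cosine basis `w_k` of `Ω`, its orthogonality and the eigen-equations `Δ^{(K)}_Ω w_k = effSym(k̂)w_k`; part Ϟ-d the limit operator `Δ^{(∞)}_Ω`.  THIS FILE adds
the COMPLETENESS of the cosine basis and the resulting EXACT spectral calculus on `Ω`, and reads NE2's unit-layer `η`-rate on King's region in OPERATOR NORM.
§1 ★ `boxWaveMatrix_mul_diagonal_mul_transpose` (`W·diag(weight)⁻¹·Wᵀ = 1`), ★★ **`sum_boxWave_mul_boxWave_div_weight`** (COMPLETENESS `Σ_k w_k(s)w_k(t)∕weight_k = δ_{st}`), def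
**`boxWaveCoeff n f = Wᵀf`** (`(Wᵀf)_k = Σ_s w_k(s)f(s)`), ★★ **`boxWave_expansion`** (`f = Σ_k (Wᵀf)_k·w_k∕weight_k`), `transpose_eq_of_boxWave_eigen` (all-`w_k`-eigenvectors ⇒ symmetric),
★★ **`dotProduct_mulVec_eq_sum_boxWaveCoeff`** (`⟨f,Bf⟩ = Σ_k σ_k(Wᵀf)_k²∕weight_k`), ★★ **`dotProduct_self_eq_sum_boxWaveCoeff`** (PARSEVAL `‖f‖² = Σ_k (Wᵀf)_k²∕weight_k`),
★★ **`mulVec_dotProduct_mulVec_eq_sum_boxWaveCoeff`** (`‖Bf‖² = Σ_k σ_k²(Wᵀf)_k²∕weight_k`).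
§2 ★★ **`dotProduct_mulVec_bounds_of_boxWave_eigen`** (`lo‖f‖² ≤ ⟨f,Bf⟩ ≤ hi‖f‖²` from `lo ≤ σ_k ≤ hi`), ★★ **`mulVec_sq_le_of_boxWave_eigen`** (`‖Bf‖² ≤ M²‖f‖²` from `|σ_k| ≤ M` —
the operator norm of `B` is `max_k|σ_k|`).
§3 ★ `foldOp_effLaplacianLim_mulVec_boxWave` (`Δ^{(∞)}_Ω w_k = effSymLim(πk∕n)w_k`, by limits), `foldOp_effLaplacianLim_inv_mulVec_boxWave`, ★ `blockCovBoxDiff_mulVec_boxWave`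
(`((Δ^{(K)}_Ω)⁻¹ − (Δ^{(∞)}_Ω)⁻¹)w_k = (effSym_K(k̂)⁻¹ − effSymLim(k̂)⁻¹)w_k`), ★ `abs_inv_effSym_sub_inv_lim_le_dblBox` (`|effSym_K(k̂)⁻¹ − effSymLim(k̂)⁻¹| ≤ δ_∞⁻²·C_Δ(a)·L^{−2K}`),
★★★ **`blockCov_box_sub_lim_mulVec_sq_le`** (NE2's UNIT LAYER ON `Ω` IN OPERATOR NORM: `‖((Δ^{(K)}_Ω)⁻¹ − (Δ^{(∞)}_Ω)⁻¹)f‖² ≤ (δ_∞⁻²C_Δ(a)L^{−2K})²‖f‖²` for every `f`, every box —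
rate `η² = L^{−2K}`), ★★ **`abs_dotProduct_blockCov_box_sub_lim_le`** (the quadratic-form version), ★★ `blockCov_box_mulVec_sq_le` ∕ `dotProduct_blockCov_box_bounds` (the unit-layer
covariance itself: `(1+a∕m²)⁻¹a⁻¹… `-type exact bounds `a⁻¹ ≤ ⟨f,(Δ^{(K)}_Ω)⁻¹f⟩∕‖f‖² ≤ a⁻¹ + m⁻²`).

PRIOR TREE ART (named, USED not restated): Ϟ-a (`boxWave`, `boxWaveWeight`, `boxWaveMatrix`, `boxWaveMatrix_transpose_mul_self`, `isUnit_det_boxWaveMatrix`,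
`eq_conj_diagonal_of_boxWave_eigen`, `inv_mulVec_boxWave_of_eigen`), Ϟ-c (`boxWaveMatrix_inv_eq`, `eq_mul_diagonal_mul_transpose_of_boxWave_eigen`,
`foldOp_effLaplacian_mulVec_boxWave`, `foldOp_effLaplacian_inv_mulVec_boxWave`), Ϟ-d (`tendsto_foldOp_effLaplacian`, `tendsto_matrix_apply`), Ε-n (`effSym_bounds`, `effSym_pos'`),
the continuum-symbol files (`effSym_eq_DeltaEff`, `DeltaEff_ge_unif`, `effSymLim_ge_unif`, `abs_DeltaEff_sub_lim_le`, `tendsto_effSym_pow`, `aInf_pos`).  NOT Bałaban's covariant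
objects; NOT a node discharge (N15 is booked through n15-a's knit, untouched); nothing continuum-YM ∕ `ℝ⁴` ∕ OS ∕ Clay.  0 `sorry`; 1 `def` (`boxWaveCoeff`).

HONEST SCOPE.  Finite-dimensional real spectral calculus on `Ω = Π_μFin n_μ` for matrices diagonal in the cosine basis; §3 is King's `A = 0` model, `L` odd `≥ 2`, `a, m² > 0`,
`K ≥ 1`; the operator-norm rate carries NO spatial-decay information (part Ν-i's entrywise unit-layer rate with decay on `Ω` is the complementary statement).  Locators: [King1986]
(2.14) p.653, Lemma 4.3 (4.18) p.672, (4.5) p.670, (4.8) p.671, §4 p.670 l.8–13.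
-/

noncomputable section

open scoped BigOperators Topology
open Finset Filter Matrix

namespace Summit.QuantumFields.YangMills.BalabanUVNodes.N15KingModelRung.TorusSpectral

open Literature.MathematicalPhysics.QuantumFieldTheory.Balaban1983to89.B5Prop11Plancherel (Tor sOf)
open Literature.MathematicalPhysics.QuantumFieldTheory.King1986 (aK aK_pos DeltaEff)
open Literature.MathematicalPhysics.QuantumFieldTheory.King1986.Torus

variable {d : ℕ}

/-! ## §1 Completeness of the cosine basis; Parseval; quadratic forms -/

section Completeness

variable (n : Fin (d + 1) → ℕ) [hn : ∀ μ, NeZero (n μ)]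

/-- ★ `W·diag(weight)⁻¹·Wᵀ = 1` (the cosine matrix times its inverse). [folklore] -/
theorem boxWaveMatrix_mul_diagonal_mul_transpose :
    boxWaveMatrix n * Matrix.diagonal (fun k => (boxWaveWeight n k)⁻¹) * (boxWaveMatrix n)ᵀ = 1 := by
  rw [Matrix.mul_assoc, ← boxWaveMatrix_inv_eq, Matrix.mul_nonsing_inv _ (isUnit_det_boxWaveMatrix n)]

/-- ★★ **COMPLETENESS OF THE COSINE BASIS**: `Σ_{k∈Ω} w_k(s)w_k(t)∕weight_k = δ_{st}`. [folklore] -/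
theorem sum_boxWave_mul_boxWave_div_weight (s t : KingBox n) :
    ∑ k : KingBox n, boxWave n k s * boxWave n k t / boxWaveWeight n k = if s = t then 1 else 0 := by
  have h := congrFun (congrFun (boxWaveMatrix_mul_diagonal_mul_transpose n) s) t
  rw [Matrix.mul_apply, Matrix.one_apply] at h
  rw [← h]
  refine Finset.sum_congr rfl fun k _ => ?_
  rw [Matrix.mul_diagonal, Matrix.transpose_apply]
  simp only [boxWaveMatrix]
  ring

/-- THE COSINE COEFFICIENTS `(Wᵀf)_k = Σ_s w_k(s)f(s)` of a function on `Ω`. [folklore] -/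
def boxWaveCoeff (f : KingBox n → ℝ) : KingBox n → ℝ := (boxWaveMatrix n)ᵀ *ᵥ f

omit hn in
/-- `(Wᵀf)_k = Σ_s w_k(s)f(s)`. [folklore] -/
theorem boxWaveCoeff_apply (f : KingBox n → ℝ) (k : KingBox n) : boxWaveCoeff n f k = ∑ s, boxWave n k s * f s := by
  simp only [boxWaveCoeff, Matrix.mulVec, dotProduct, Matrix.transpose_apply, boxWaveMatrix]

/-- ★★ **EXPANSION IN THE COSINE BASIS**: `f(s) = Σ_k (Wᵀf)_k·w_k(s)∕weight_k`. [folklore] -/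
theorem boxWave_expansion (f : KingBox n → ℝ) (s : KingBox n) : f s = ∑ k : KingBox n, boxWaveCoeff n f k * boxWave n k s / boxWaveWeight n k := by
  symm
  calc ∑ k : KingBox n, boxWaveCoeff n f k * boxWave n k s / boxWaveWeight n k
      = ∑ k : KingBox n, ∑ t : KingBox n, (boxWave n k s * boxWave n k t / boxWaveWeight n k) * f t := by
        refine Finset.sum_congr rfl fun k _ => ?_
        rw [boxWaveCoeff_apply, Finset.sum_mul, Finset.sum_div]
        exact Finset.sum_congr rfl fun t _ => by ring
    _ = ∑ t : KingBox n, ∑ k : KingBox n, (boxWave n k s * boxWave n k t / boxWaveWeight n k) * f t := Finset.sum_comm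
    _ = ∑ t : KingBox n, (∑ k : KingBox n, boxWave n k s * boxWave n k t / boxWaveWeight n k) * f t :=
        Finset.sum_congr rfl fun t _ => (Finset.sum_mul _ _ _).symm
    _ = ∑ t : KingBox n, (if s = t then (1 : ℝ) else 0) * f t := Finset.sum_congr rfl fun t _ => by rw [sum_boxWave_mul_boxWave_div_weight]
    _ = f s := by simp only [ite_mul, one_mul, zero_mul, Finset.sum_ite_eq, Finset.mem_univ, if_true]

omit hn in
/-- a matrix with all cosine waves as eigenvectors is symmetric (`B = W·diag(σ∕weight)·Wᵀ`). [folklore] -/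
theorem transpose_eq_of_boxWave_eigen [hn : ∀ μ, NeZero (n μ)] (B : Matrix (KingBox n) (KingBox n) ℝ) (σ : KingBox n → ℝ) (hB : ∀ k, B *ᵥ boxWave n k = σ k • boxWave n k) :
    Bᵀ = B := by
  rw [eq_mul_diagonal_mul_transpose_of_boxWave_eigen n B σ hB, Matrix.transpose_mul, Matrix.transpose_mul, Matrix.transpose_transpose, Matrix.diagonal_transpose,
    Matrix.mul_assoc]

/-- ★★ **THE QUADRATIC FORM IN THE COSINE BASIS**: `⟨f, Bf⟩ = Σ_k σ_k·(Wᵀf)_k²∕weight_k`. [folklore] -/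
theorem dotProduct_mulVec_eq_sum_boxWaveCoeff (B : Matrix (KingBox n) (KingBox n) ℝ) (σ : KingBox n → ℝ) (hB : ∀ k, B *ᵥ boxWave n k = σ k • boxWave n k) (f : KingBox n → ℝ) :
    f ⬝ᵥ (B *ᵥ f) = ∑ k : KingBox n, σ k * boxWaveCoeff n f k ^ 2 / boxWaveWeight n k := by
  conv_lhs => rw [eq_mul_diagonal_mul_transpose_of_boxWave_eigen n B σ hB]
  rw [← Matrix.mulVec_mulVec, ← Matrix.mulVec_mulVec, Matrix.dotProduct_mulVec, ← Matrix.mulVec_transpose]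
  simp only [boxWaveCoeff, dotProduct, Matrix.mulVec_diagonal]
  refine Finset.sum_congr rfl fun k _ => ?_
  ring

/-- ★★ **PARSEVAL**: `‖f‖² = Σ_k (Wᵀf)_k²∕weight_k`. [folklore] -/
theorem dotProduct_self_eq_sum_boxWaveCoeff (f : KingBox n → ℝ) : f ⬝ᵥ f = ∑ k : KingBox n, boxWaveCoeff n f k ^ 2 / boxWaveWeight n k := by
  have h := dotProduct_mulVec_eq_sum_boxWaveCoeff n 1 (fun _ => 1) (fun k => by rw [Matrix.one_mulVec, one_smul]) f
  rw [Matrix.one_mulVec] at h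
  rw [h]
  exact Finset.sum_congr rfl fun k _ => by rw [one_mul]

/-- ★★ **`‖Bf‖² = Σ_k σ_k²·(Wᵀf)_k²∕weight_k`.** [folklore] -/
theorem mulVec_dotProduct_mulVec_eq_sum_boxWaveCoeff (B : Matrix (KingBox n) (KingBox n) ℝ) (σ : KingBox n → ℝ) (hB : ∀ k, B *ᵥ boxWave n k = σ k • boxWave n k)
    (f : KingBox n → ℝ) : (B *ᵥ f) ⬝ᵥ (B *ᵥ f) = ∑ k : KingBox n, σ k ^ 2 * boxWaveCoeff n f k ^ 2 / boxWaveWeight n k := by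
  have hBB : ∀ k, (B * B) *ᵥ boxWave n k = (σ k ^ 2) • boxWave n k := fun k => by
    rw [← Matrix.mulVec_mulVec, hB, Matrix.mulVec_smul, hB, smul_smul, sq]
  have h := dotProduct_mulVec_eq_sum_boxWaveCoeff n (B * B) (fun k => σ k ^ 2) hBB f
  rw [← Matrix.mulVec_mulVec, Matrix.dotProduct_mulVec, ← Matrix.mulVec_transpose, transpose_eq_of_boxWave_eigen n B σ hB] at h
  exact h

end Completeness

/-! ## §2 Exact quadratic-form spectral bounds -/

section Bounds

variable (n : Fin (d + 1) → ℕ) [hn : ∀ μ, NeZero (n μ)]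

/-- ★★ **SPECTRAL BOUNDS OF THE QUADRATIC FORM**: `lo ≤ σ_k ≤ hi` for all `k` ⇒ `lo·‖f‖² ≤ ⟨f,Bf⟩ ≤ hi·‖f‖²`. [folklore] -/
theorem dotProduct_mulVec_bounds_of_boxWave_eigen (B : Matrix (KingBox n) (KingBox n) ℝ) (σ : KingBox n → ℝ) (hB : ∀ k, B *ᵥ boxWave n k = σ k • boxWave n k)
    {lo hi : ℝ} (hlo : ∀ k, lo ≤ σ k) (hhi : ∀ k, σ k ≤ hi) (f : KingBox n → ℝ) :
    lo * (f ⬝ᵥ f) ≤ f ⬝ᵥ (B *ᵥ f) ∧ f ⬝ᵥ (B *ᵥ f) ≤ hi * (f ⬝ᵥ f) := by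
  rw [dotProduct_mulVec_eq_sum_boxWaveCoeff n B σ hB f, dotProduct_self_eq_sum_boxWaveCoeff n f, Finset.mul_sum, Finset.mul_sum]
  have hw : ∀ k, 0 ≤ boxWaveCoeff n f k ^ 2 / boxWaveWeight n k := fun k => div_nonneg (sq_nonneg _) (boxWaveWeight_pos n k).le
  constructor
  · refine Finset.sum_le_sum fun k _ => ?_
    rw [mul_div_assoc]
    exact mul_le_mul_of_nonneg_right (hlo k) (hw k)
  · refine Finset.sum_le_sum fun k _ => ?_
    rw [mul_div_assoc]
    exact mul_le_mul_of_nonneg_right (hhi k) (hw k)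

/-- ★★ **THE OPERATOR NORM IS `max_k|σ_k|`**: `|σ_k| ≤ M` for all `k` ⇒ `‖Bf‖² ≤ M²·‖f‖²`. [folklore] -/
theorem mulVec_sq_le_of_boxWave_eigen (B : Matrix (KingBox n) (KingBox n) ℝ) (σ : KingBox n → ℝ) (hB : ∀ k, B *ᵥ boxWave n k = σ k • boxWave n k)
    {M : ℝ} (hM : ∀ k, |σ k| ≤ M) (f : KingBox n → ℝ) : (B *ᵥ f) ⬝ᵥ (B *ᵥ f) ≤ M ^ 2 * (f ⬝ᵥ f) := by
  rw [mulVec_dotProduct_mulVec_eq_sum_boxWaveCoeff n B σ hB f, dotProduct_self_eq_sum_boxWaveCoeff n f, Finset.mul_sum]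
  refine Finset.sum_le_sum fun k _ => ?_
  rw [mul_div_assoc]
  refine mul_le_mul_of_nonneg_right ?_ (div_nonneg (sq_nonneg _) (boxWaveWeight_pos n k).le)
  rw [← sq_abs (σ k)]
  exact pow_le_pow_left₀ (abs_nonneg _) (hM k) 2

/-- ★ the quadratic form of a matrix with `|σ_k| ≤ M`: `|⟨f,Bf⟩| ≤ M·‖f‖²`. [folklore] -/
theorem abs_dotProduct_mulVec_le_of_boxWave_eigen (B : Matrix (KingBox n) (KingBox n) ℝ) (σ : KingBox n → ℝ) (hB : ∀ k, B *ᵥ boxWave n k = σ k • boxWave n k)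
    {M : ℝ} (hM : ∀ k, |σ k| ≤ M) (f : KingBox n → ℝ) : |f ⬝ᵥ (B *ᵥ f)| ≤ M * (f ⬝ᵥ f) := by
  have h := dotProduct_mulVec_bounds_of_boxWave_eigen n B σ hB (lo := -M) (hi := M) (fun k => (abs_le.mp (hM k)).1) (fun k => (abs_le.mp (hM k)).2) f
  rw [abs_le]
  constructor <;> linarith [h.1, h.2]

end Bounds

/-! ## §3 NE2's unit layer on King's region `Ω` in operator norm -/

section UnitLayer

variable (L : ℕ) (n : Fin (d + 1) → ℕ) [hn : ∀ μ, NeZero (n μ)]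

/-- ★ `Δ^{(∞)}_Ω w_k = effSymLim(πk∕n)·w_k` (the eigen-equation passes to the limit `K → ∞`). [cite: King1986, (2.14) p.653, (4.5) p.670, Thm 3.4 (3.9) p.656] -/
theorem foldOp_effLaplacianLim_mulVec_boxWave (hLodd : Odd L) (hL : 2 ≤ L) {a m2 : ℝ} (ha : 0 < a) (hm : 0 < m2) (k : KingBox n) :
    foldOp n (Matrix.of fun b b' => effLaplacianLim L (dblPer n) a m2 b b') *ᵥ boxWave n k = effSymLim a L m2 (sOf (dblPer n) (dblBox n k)) • boxWave n k := by
  haveI : NeZero L := ⟨by omega⟩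
  have hL1 : (1 : ℝ) < L := by exact_mod_cast (show 1 < L by omega)
  have hA := tendsto_foldOp_effLaplacian L n hLodd hL ha hm
  -- both sides of the eigen-equation converge
  have h1 : Tendsto (fun K : ℕ => foldOp n (effLaplacian (L ^ K) (dblPer n) (aK a L K) (((L ^ K : ℕ) : ℝ) ^ 2) m2) *ᵥ boxWave n k) atTop
      (𝓝 (foldOp n (Matrix.of fun b b' => effLaplacianLim L (dblPer n) a m2 b b') *ᵥ boxWave n k)) :=
    ((Continuous.matrix_mulVec continuous_id continuous_const).tendsto _).comp hA
  have h2 : Tendsto (fun K : ℕ => effSym (L ^ K) (dblPer n) (aK a L K) (((L ^ K : ℕ) : ℝ) ^ 2) m2 (dblBox n k) • boxWave n k) atTop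
      (𝓝 (effSymLim a L m2 (sOf (dblPer n) (dblBox n k)) • boxWave n k)) :=
    (tendsto_effSym_pow L (dblPer n) hLodd hL ha hm (dblBox n k)).smul_const _
  refine tendsto_nhds_unique (h1.congr' ?_) h2
  filter_upwards [eventually_ge_atTop 1] with K hK
  exact foldOp_effLaplacian_mulVec_boxWave (L ^ K) n (aK_pos ha hL1 hK).le (by positivity) hm k

/-- `(Δ^{(∞)}_Ω)⁻¹ w_k = effSymLim(πk∕n)⁻¹·w_k`. [cite: King1986, (2.14) p.653, (4.5) p.670] -/
theorem foldOp_effLaplacianLim_inv_mulVec_boxWave (hLodd : Odd L) (hL : 2 ≤ L) {a m2 : ℝ} (ha : 0 < a) (hm : 0 < m2) (k : KingBox n) :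
    (foldOp n (Matrix.of fun b b' => effLaplacianLim L (dblPer n) a m2 b b'))⁻¹ *ᵥ boxWave n k = (effSymLim a L m2 (sOf (dblPer n) (dblBox n k)))⁻¹ • boxWave n k := by
  have hL1 : (1 : ℝ) < L := by exact_mod_cast (show 1 < L by omega)
  refine inv_mulVec_boxWave_of_eigen n _ (fun k' => effSymLim a L m2 (sOf (dblPer n) (dblBox n k'))) (foldOp_effLaplacianLim_mulVec_boxWave L n hLodd hL ha hm)
    (fun k' => (lt_of_lt_of_le (by have := aInf_pos ha hL1; positivity) (effSymLim_ge_unif L (dblPer n) hLodd hL ha hm (dblBox n k'))).ne') k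

/-- ★ the difference of NE2's unit-layer kernels on the cosine waves: `((Δ^{(K)}_Ω)⁻¹ − (Δ^{(∞)}_Ω)⁻¹)w_k = (effSym_K(k̂)⁻¹ − effSymLim(k̂)⁻¹)·w_k`. [cite: King1986, (2.14) p.653, (4.5) p.670] -/
theorem blockCovBoxDiff_mulVec_boxWave (hLodd : Odd L) (hL : 2 ≤ L) {a m2 : ℝ} (ha : 0 < a) (hm : 0 < m2) {K : ℕ} (hK : 1 ≤ K) (k : KingBox n) :
    haveI : NeZero L := ⟨by omega⟩
    ((foldOp n (effLaplacian (L ^ K) (dblPer n) (aK a L K) (((L ^ K : ℕ) : ℝ) ^ 2) m2))⁻¹ - (foldOp n (Matrix.of fun b b' => effLaplacianLim L (dblPer n) a m2 b b'))⁻¹) *ᵥ boxWave n k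
      = ((effSym (L ^ K) (dblPer n) (aK a L K) (((L ^ K : ℕ) : ℝ) ^ 2) m2 (dblBox n k))⁻¹ - (effSymLim a L m2 (sOf (dblPer n) (dblBox n k)))⁻¹) • boxWave n k := by
  haveI : NeZero L := ⟨by omega⟩
  have hL1 : (1 : ℝ) < L := by exact_mod_cast (show 1 < L by omega)
  rw [Matrix.sub_mulVec, foldOp_effLaplacian_inv_mulVec_boxWave (L ^ K) n (aK_pos ha hL1 hK) (by positivity) hm k,
    foldOp_effLaplacianLim_inv_mulVec_boxWave L n hLodd hL ha hm k, sub_smul]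

/-- ★ the per-momentum rate of the INVERSE symbols: `|effSym_K(k̂)⁻¹ − effSymLim(k̂)⁻¹| ≤ δ_∞⁻²·C_Δ(a)·L^{−2K}` (`|x⁻¹ − y⁻¹| = |x−y|∕(xy)`, `x, y ≥ δ_∞`).
[cite: King1986, Lemma 4.3 (4.18) p.672, (4.8) p.671] -/
theorem abs_inv_effSym_sub_inv_lim_le_dblBox (hLodd : Odd L) (hL : 2 ≤ L) {a m2 : ℝ} (ha : 0 < a) (hm : 0 < m2) {K : ℕ} (hK : 1 ≤ K) (k : KingBox n) :
    haveI : NeZero L := ⟨by omega⟩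
    |(effSym (L ^ K) (dblPer n) (aK a L K) (((L ^ K : ℕ) : ℝ) ^ 2) m2 (dblBox n k))⁻¹ - (effSymLim a L m2 (sOf (dblPer n) (dblBox n k)))⁻¹|
      ≤ (((aInf a L)⁻¹ + m2⁻¹) ^ 2 * (8 / 3 * (a ^ 2 * (a⁻¹ + Real.pi ^ 2 / 48 + 1 / 3)) + 4 / 3 * a)) * ((L : ℝ) ^ (2 * K))⁻¹ := by
  haveI : NeZero L := ⟨by omega⟩
  have hL1 : (1 : ℝ) < L := by exact_mod_cast (show 1 < L by omega)
  have haK := aK_pos ha hL1 hK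
  have haI := aInf_pos ha hL1
  have hLK : 1 ≤ L ^ K := Nat.one_le_pow K L (by omega)
  set δ : ℝ := ((aInf a L)⁻¹ + m2⁻¹)⁻¹ with hδ
  have hδ0 : 0 < δ := by positivity
  rw [effSym_eq_DeltaEff (L ^ K) (dblPer n) hLK haK hm (dblBox n k)]
  set x := DeltaEff (aK a L K) (L ^ K) m2 (sOf (dblPer n) (dblBox n k)) with hx
  set y := effSymLim a L m2 (sOf (dblPer n) (dblBox n k)) with hy
  have hxδ : δ ≤ x := DeltaEff_ge_unif L (dblPer n) hL ha hm hK (dblBox n k)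
  have hyδ : δ ≤ y := effSymLim_ge_unif L (dblPer n) hLodd hL ha hm (dblBox n k)
  have hx0 : 0 < x := lt_of_lt_of_le hδ0 hxδ
  have hy0 : 0 < y := lt_of_lt_of_le hδ0 hyδ
  have hr := abs_DeltaEff_sub_lim_le L (dblPer n) hLodd hL ha hm hK (dblBox n k)
  have hident : x⁻¹ - y⁻¹ = (y - x) / (x * y) := by field_simp
  rw [hident, abs_div, abs_of_pos (mul_pos hx0 hy0), abs_sub_comm]
  have hxy : δ ^ 2 ≤ x * y := by rw [sq]; exact mul_le_mul hxδ hyδ hδ0.le hx0.le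
  calc |x - y| / (x * y) ≤ |x - y| / δ ^ 2 := div_le_div_of_nonneg_left (abs_nonneg _) (by positivity) hxy
    _ ≤ (8 / 3 * (a ^ 2 * (a⁻¹ + Real.pi ^ 2 / 48 + 1 / 3)) + 4 / 3 * a) * ((L : ℝ) ^ (2 * K))⁻¹ / δ ^ 2 := div_le_div_of_nonneg_right hr (by positivity)
    _ = _ := by rw [hδ, inv_pow, div_eq_mul_inv, inv_inv]; ring

/-- ★★★ **NE2's UNIT LAYER ON KING's REGION IN OPERATOR NORM — THE `η²`-RATE, UNIFORM IN THE BOX**: for `L` odd `≥ 2`, `a, m² > 0`, `K ≥ 1`, every box `Ω` of blocks and every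
`f : Ω → ℝ`: `‖((Δ^{(K)}_Ω)⁻¹ − (Δ^{(∞)}_Ω)⁻¹)f‖² ≤ (δ_∞⁻²·C_Δ(a)·L^{−2K})²·‖f‖²`. [cite: King1986, (2.14) p.653, Lemma 4.3 (4.18) p.672, (4.8) p.671, §4 p.670 l.8–13] -/
theorem blockCov_box_sub_lim_mulVec_sq_le (hLodd : Odd L) (hL : 2 ≤ L) {a m2 : ℝ} (ha : 0 < a) (hm : 0 < m2) {K : ℕ} (hK : 1 ≤ K) (f : KingBox n → ℝ) :
    haveI : NeZero L := ⟨by omega⟩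
    (((foldOp n (effLaplacian (L ^ K) (dblPer n) (aK a L K) (((L ^ K : ℕ) : ℝ) ^ 2) m2))⁻¹ - (foldOp n (Matrix.of fun b b' => effLaplacianLim L (dblPer n) a m2 b b'))⁻¹) *ᵥ f)
        ⬝ᵥ (((foldOp n (effLaplacian (L ^ K) (dblPer n) (aK a L K) (((L ^ K : ℕ) : ℝ) ^ 2) m2))⁻¹ - (foldOp n (Matrix.of fun b b' => effLaplacianLim L (dblPer n) a m2 b b'))⁻¹) *ᵥ f)
      ≤ ((((aInf a L)⁻¹ + m2⁻¹) ^ 2 * (8 / 3 * (a ^ 2 * (a⁻¹ + Real.pi ^ 2 / 48 + 1 / 3)) + 4 / 3 * a)) * ((L : ℝ) ^ (2 * K))⁻¹) ^ 2 * (f ⬝ᵥ f) := by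
  haveI : NeZero L := ⟨by omega⟩
  exact mulVec_sq_le_of_boxWave_eigen n _ _ (blockCovBoxDiff_mulVec_boxWave L n hLodd hL ha hm hK) (abs_inv_effSym_sub_inv_lim_le_dblBox L n hLodd hL ha hm hK) f

/-- ★★ **THE QUADRATIC-FORM VERSION**: `|⟨f, ((Δ^{(K)}_Ω)⁻¹ − (Δ^{(∞)}_Ω)⁻¹)f⟩| ≤ δ_∞⁻²·C_Δ(a)·L^{−2K}·‖f‖²`. [cite: King1986, (2.14) p.653, Lemma 4.3 (4.18) p.672, §4 p.670] -/
theorem abs_dotProduct_blockCov_box_sub_lim_le (hLodd : Odd L) (hL : 2 ≤ L) {a m2 : ℝ} (ha : 0 < a) (hm : 0 < m2) {K : ℕ} (hK : 1 ≤ K) (f : KingBox n → ℝ) :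
    haveI : NeZero L := ⟨by omega⟩
    |f ⬝ᵥ (((foldOp n (effLaplacian (L ^ K) (dblPer n) (aK a L K) (((L ^ K : ℕ) : ℝ) ^ 2) m2))⁻¹ - (foldOp n (Matrix.of fun b b' => effLaplacianLim L (dblPer n) a m2 b b'))⁻¹) *ᵥ f)|
      ≤ (((aInf a L)⁻¹ + m2⁻¹) ^ 2 * (8 / 3 * (a ^ 2 * (a⁻¹ + Real.pi ^ 2 / 48 + 1 / 3)) + 4 / 3 * a)) * ((L : ℝ) ^ (2 * K))⁻¹ * (f ⬝ᵥ f) := by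
  haveI : NeZero L := ⟨by omega⟩
  exact abs_dotProduct_mulVec_le_of_boxWave_eigen n _ _ (blockCovBoxDiff_mulVec_boxWave L n hLodd hL ha hm hK) (abs_inv_effSym_sub_inv_lim_le_dblBox L n hLodd hL ha hm hK) f

variable (N : ℕ) [NeZero N]

/-- ★★ **EXACT SPECTRAL BOUNDS OF NE2's UNIT-LAYER COVARIANCE ON `Ω`**: `a⁻¹‖f‖² ≤ ⟨f,(Δ^{(K)}_Ω)⁻¹f⟩ ≤ (a⁻¹ + m⁻²)‖f‖²` (`effSym ∈ [a∕(1+a∕m²), a]`; every `N ≥ 1`, `a > 0`, `c ≥ 0`, `m² > 0`).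
[cite: King1986, (2.14) p.653, (4.5) p.670, (4.8) p.671, §4 p.670] -/
theorem dotProduct_blockCov_box_bounds {a c m2 : ℝ} (ha : 0 < a) (hc : 0 ≤ c) (hm : 0 < m2) (f : KingBox n → ℝ) :
    a⁻¹ * (f ⬝ᵥ f) ≤ f ⬝ᵥ ((foldOp n (effLaplacian N (dblPer n) a c m2))⁻¹ *ᵥ f) ∧
      f ⬝ᵥ ((foldOp n (effLaplacian N (dblPer n) a c m2))⁻¹ *ᵥ f) ≤ (a⁻¹ + m2⁻¹) * (f ⬝ᵥ f) := by
  refine dotProduct_mulVec_bounds_of_boxWave_eigen n _ _ (foldOp_effLaplacian_inv_mulVec_boxWave N n ha hc hm) (fun k => ?_) (fun k => ?_) f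
  · exact (inv_le_inv₀ ha (effSym_pos' N (dblPer n) ha hc hm _)).mpr (effSym_bounds N (dblPer n) ha hc hm _).2
  · have hlo := (effSym_bounds N (dblPer n) ha hc hm (dblBox n k)).1
    have hpos : 0 < a / (1 + a / m2) := by positivity
    calc (effSym N (dblPer n) a c m2 (dblBox n k))⁻¹ ≤ (a / (1 + a / m2))⁻¹ := (inv_le_inv₀ (effSym_pos' N (dblPer n) ha hc hm _) hpos).mpr hlo
      _ = a⁻¹ + m2⁻¹ := by rw [inv_div, div_eq_mul_inv, add_mul, one_mul, div_mul_eq_mul_div, mul_inv_cancel₀ ha.ne', one_div]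

/-- ★★ **OPERATOR NORM OF NE2's UNIT-LAYER COVARIANCE ON `Ω`**: `‖(Δ^{(K)}_Ω)⁻¹f‖² ≤ (a⁻¹ + m⁻²)²·‖f‖²`, uniformly in the box. [cite: King1986, (2.14) p.653, (4.8) p.671, §4 p.670] -/
theorem blockCov_box_mulVec_sq_le {a c m2 : ℝ} (ha : 0 < a) (hc : 0 ≤ c) (hm : 0 < m2) (f : KingBox n → ℝ) :
    ((foldOp n (effLaplacian N (dblPer n) a c m2))⁻¹ *ᵥ f) ⬝ᵥ ((foldOp n (effLaplacian N (dblPer n) a c m2))⁻¹ *ᵥ f) ≤ (a⁻¹ + m2⁻¹) ^ 2 * (f ⬝ᵥ f) := by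
  refine mulVec_sq_le_of_boxWave_eigen n _ _ (foldOp_effLaplacian_inv_mulVec_boxWave N n ha hc hm) (fun k => ?_) f
  have hpos := effSym_pos' N (dblPer n) ha hc hm (dblBox n k)
  rw [abs_of_pos (inv_pos.mpr hpos)]
  have hlo := (effSym_bounds N (dblPer n) ha hc hm (dblBox n k)).1
  have hpos' : 0 < a / (1 + a / m2) := by positivity
  calc (effSym N (dblPer n) a c m2 (dblBox n k))⁻¹ ≤ (a / (1 + a / m2))⁻¹ := (inv_le_inv₀ hpos hpos').mpr hlo
    _ = a⁻¹ + m2⁻¹ := by rw [inv_div, div_eq_mul_inv, add_mul, one_mul, div_mul_eq_mul_div, mul_inv_cancel₀ ha.ne', one_div]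

end UnitLayer

end Summit.QuantumFields.YangMills.BalabanUVNodes.N15KingModelRung.TorusSpectral

end
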